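import Literature.Combinatorics.LorentzianPolynomials.Rayleigh
import Literature.Combinatorics.LorentzianPolynomials.WordPolynomial
import Literature.LinearAlgebra.QuadraticForm.LorentzianSignatureSum
import HarnessLib

/-!
# The Hodge–Riemann relation for Lorentzian cubics: `𝓗_F(a) = 𝓗(Σ_k a_k ∂_k F)` has at most one positive
# eigenvalue for `F ∈ L³_n` and `a ∈ ℝ^n_{≥0}` (Brändén–Huh 2020, Thm. 2.16 (2) at `d = 3`, equivalently the
# Hessian half of Cor. 2.11 / Prop. 2.7 at `d = 3`)

Layer `Literature/Combinatorics/LorentzianPolynomials`, namespace `Literature.Combinatorics.LorentzianPolynomials`;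
lane `lit-hodgefound` (Track 2 foundations library), seat p16, generation 28 (row g28-#3). One definition with body
(`dirDeriv a f = Σ_k a_k ∂_k f`, Brändén–Huh's `Σ a_i ∂_i f` of Cor. 2.11) and theorems; no named fact (net debt 0).

This is the analytic heart of Brändén–Huh's §2.2 for the tree's Definition-2.6 `lorentzian`: every Hessian condition in
`L^d_n` is a condition on the quadratic forms `∂^α f`, `|α| = d - 2`, so "`Σ a_i ∂_i f ∈ L^{d-1}_n`" (Cor. 2.11) and
"`𝓗_f(w)` has exactly one positive eigenvalue" (Thm. 2.16 (2)) both reduce to the CUBIC case proved here: for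
`F ∈ L³_n` the symmetric nonnegative 3-tensor `c_{ijk} = c_{e_i+e_j+e_k}(F)` has slices `𝓗(∂_k F) = (c_{ijk})_{ij}` with at
most one positive eigenvalue, and the claim is that every nonnegative combination `Σ_k a_k 𝓗(∂_k F) = 𝓗_F(a)` has.

## Source (verbatim) — [BrandenHuh2019] P. Brändén, J. Huh, *Lorentzian polynomials*, Ann. of Math. 192 (2020),
## arXiv:1902.03719 (held `paper:arxiv-1902.03719`), §§2.2–2.3

Proof of Prop. 2.7 (the case `α_i > 0`): "`∂^α g = ∂_i(∂^{α-e_i} f) + θ α_i ∂_j(∂^{α-e_i} f) + θ w_i ∂_i ∂_j(∂^{α-e_i} f)`.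
In this case, (1) of Lemma 2.9 applies to the stable polynomials `∂^α f` and `∂^{α-e_i+e_j} f`:
`∂_i∂_j(∂^{α-e_i} f) ≺ ∂_i(∂^{α-e_i} f)` and `∂_i∂_j(∂^{α-e_i} f) ≺ ∂_j(∂^{α-e_i} f)`. Therefore, unless `∂^{α+e_j} f` is
identically zero, `∂^α g` is stable by (2) and (4) of Lemma 2.9. It remains to prove that, whenever `α_i` is positive and
`∂^{α+e_j} f` is identically zero, `∂_i(∂^{α-e_i} f) + φ ∂_j(∂^{α-e_i} f)` is stable […] Since the cubic form `∂^{α-e_i} f`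
is in `L³_n`, it is enough to prove the statement when `d = 3` and `α = e_i`. […] We apply the symmetric exchange
property to the support of `f` […] Since stability is a closed condition, it follows that `lim_{s→0} […] = ∂_i f + φ ∂_j f`
is stable". Cor. 2.11: "If `f ∈ L^d_n`, then `Σ_{i=1}^n a_i ∂_i f ∈ L^{d-1}_n` for any `a_1, …, a_n ≥ 0`." Thm. 2.16 (2):
"If `f` is in `L^d_n`, then `𝓗_f(w)` has exactly one positive eigenvalue for all `w ∈ ℝ^n_{>0}`."

## The proof given here (linear algebra; the stable-polynomial steps of Brändén–Huh replaced by their signature shadows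
## of `LorentzianSignatureSum`)

Write `H(a) = Σ_k a_k 𝓗(∂_k F)`. (i) TWO-TERM GROWTH STEP (`sigPos_hessian_dirDeriv_insert_le_one`): if `sigPos H(b_S) ≤ 1`
for the restriction `b_S` of `b > 0` to a set `S` of indices and `n ∉ S` has `∂_n ∂_k F ≠ 0` for some `k ∈ S`, then
`sigPos H(b_{S ∪ {n}}) ≤ 1`: the vector `u = H(b_S) e_n = 𝓗(∂_n F) b_S` is nonzero, and bordering both `H(b_S)` and
`b_n 𝓗(∂_n F)` by `u` (Lemma 2.9 (1), `sigPos_bordered_mulVec_le`) produces two forms with at most one positive square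
sharing the isotropic vector `e_{n+1}` and the functional `u` (Lemma 2.9 (4), `sigPos_add_le_one_of_isotropic`). (ii)
CONNECTIVITY FROM M-CONVEXITY (`exists_pderiv_pderiv_ne_zero_of_subset`): if `∅ ≠ S ⊊ {k : ∂_k F ≠ 0}` then some `n ∉ S`, `k ∈ S` have
`∂_n ∂_k F ≠ 0` — Brändén–Huh's exchange-property step. (iii) Growing from a singleton (`sigPos 𝓗(∂_k F) ≤ 1` is
`F ∈ L³`) gives `sigPos H(b) ≤ 1` for every `b > 0` (`sigPos_hessian_dirDeriv_le_one_of_pos`), and for `a ≥ 0` one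
perturbs, `H(a + ε𝟙) = H(a) + ε H(𝟙)`, and lets `ε → 0` ("stability is a closed condition",
`sigPos_le_one_of_forall_pos_add_smul`): **`sigPos_hessian_dirDeriv_le_one`**.
-/

noncomputable section

open MvPolynomial Finsupp Finset Matrix
open Literature.LinearAlgebra.QuadraticForm

namespace Literature.Combinatorics.LorentzianPolynomials

variable {σ : Type*}

/-! ## §1 The nonnegative directional derivative `D_a f = Σ_k a_k ∂_k f` and its Hessian -/

section DirDeriv

variable [Fintype σ]

/-- **The directional derivative `D_a f = Σ_k a_k ∂_k f`** (Brändén–Huh's `Σ_{i=1}^n a_i ∂_i f`).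
[cite: BrandenHuh2019, §2.2 Cor. 2.11] -/
def dirDeriv (a : σ → ℝ) (f : MvPolynomial σ ℝ) : MvPolynomial σ ℝ := ∑ k, a k • pderiv k f

/-- `D_a f = Σ_k a_k ∂_k f`. [cite: BrandenHuh2019, §2.2 Cor. 2.11] -/
theorem dirDeriv_def (a : σ → ℝ) (f : MvPolynomial σ ℝ) : dirDeriv a f = ∑ k, a k • pderiv k f := rfl

/-- `coeff_β (D_a f) = Σ_k a_k coeff_β(∂_k f)`. [cite: BrandenHuh2019, §2.2 Cor. 2.11] -/
theorem coeff_dirDeriv (a : σ → ℝ) (f : MvPolynomial σ ℝ) (β : σ →₀ ℕ) :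
    coeff β (dirDeriv a f) = ∑ k, a k * coeff β (pderiv k f) := by
  rw [dirDeriv, coeff_sum]
  exact Finset.sum_congr rfl fun k _ ↦ by rw [coeff_smul, smul_eq_mul]

/-- `D_a f` has nonnegative coefficients when `f` has and `a ≥ 0`. [cite: BrandenHuh2019, §2.2 Cor. 2.11] -/
theorem coeff_dirDeriv_nonneg {a : σ → ℝ} (ha : ∀ k, 0 ≤ a k) {f : MvPolynomial σ ℝ} (hf : ∀ α, 0 ≤ coeff α f)
    (β : σ →₀ ℕ) : 0 ≤ coeff β (dirDeriv a f) := by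
  rw [coeff_dirDeriv]
  exact Finset.sum_nonneg fun k _ ↦ mul_nonneg (ha k) (coeff_pderiv_nonneg hf k β)

/-- `D_a f` is homogeneous of degree `d` when `f` is homogeneous of degree `d + 1`. [cite: BrandenHuh2019, §2.2 Cor. 2.11] -/
theorem isHomogeneous_dirDeriv (a : σ → ℝ) {f : MvPolynomial σ ℝ} {d : ℕ} (hf : f.IsHomogeneous (d + 1)) :
    (dirDeriv a f).IsHomogeneous d := by
  rw [dirDeriv]
  refine IsHomogeneous.sum _ _ _ fun k _ ↦ ?_
  rw [smul_eq_C_mul]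
  simpa using (isHomogeneous_C σ (a k)).mul (hf.pderiv (i := k))

/-- `D_a` on constant directions supported in a set `S`: restricting `a` to `S` drops the terms outside `S`.
`D_{a + b} f = D_a f + D_b f`. [cite: BrandenHuh2019, §2.2 Cor. 2.11] -/
theorem dirDeriv_add (a b : σ → ℝ) (f : MvPolynomial σ ℝ) : dirDeriv (a + b) f = dirDeriv a f + dirDeriv b f := by
  simp only [dirDeriv, Pi.add_apply, add_smul, Finset.sum_add_distrib]

/-- `D_{c a} f = c · D_a f`. [cite: BrandenHuh2019, §2.2 Cor. 2.11] -/
theorem dirDeriv_smul (c : ℝ) (a : σ → ℝ) (f : MvPolynomial σ ℝ) : dirDeriv (c • a) f = c • dirDeriv a f := by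
  simp only [dirDeriv, Pi.smul_apply, smul_eq_mul, mul_smul, Finset.smul_sum]

/-- `D_{e_n} f = ∂_n f`. [cite: BrandenHuh2019, §2.2 Cor. 2.11] -/
theorem dirDeriv_single [DecidableEq σ] (n : σ) (c : ℝ) (f : MvPolynomial σ ℝ) :
    dirDeriv (Pi.single n c) f = c • pderiv n f := by
  rw [dirDeriv, Finset.sum_eq_single n]
  · rw [Pi.single_eq_same]
  · intro k _ hk; rw [Pi.single_eq_of_ne hk, zero_smul]
  · intro h; exact absurd (Finset.mem_univ n) h

/-- If `∂_k f = 0` whenever `a_k ≠ b_k`, then `D_a f = D_b f`. [cite: BrandenHuh2019, §2.2 Cor. 2.11] -/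
theorem dirDeriv_congr {a b : σ → ℝ} {f : MvPolynomial σ ℝ} (h : ∀ k, a k ≠ b k → pderiv k f = 0) :
    dirDeriv a f = dirDeriv b f := by
  refine Finset.sum_congr rfl fun k _ ↦ ?_
  by_cases hk : a k = b k
  · rw [hk]
  · rw [h k hk, smul_zero, smul_zero]

omit [Fintype σ] in
/-- The Hessian is additive. [cite: BrandenHuh2019, §2.1 (p. 8, "the symmetric matrix `𝓗_f`")] -/
theorem hessian_add (p q : MvPolynomial σ ℝ) : hessian (p + q) = hessian p + hessian q := by
  ext i j; simp only [hessian_apply, map_add, coeff_add, Matrix.add_apply]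

omit [Fintype σ] in
/-- The Hessian of a finite sum. [cite: BrandenHuh2019, §2.1 (p. 8, "the symmetric matrix `𝓗_f`")] -/
theorem hessian_sum {ι : Type*} (s : Finset ι) (g : ι → MvPolynomial σ ℝ) :
    hessian (∑ k ∈ s, g k) = ∑ k ∈ s, hessian (g k) := by
  classical
  induction s using Finset.induction_on with
  | empty =>
    rw [Finset.sum_empty, Finset.sum_empty]
    ext i j; simp [hessian_apply]
  | insert k s hk ih => rw [Finset.sum_insert hk, Finset.sum_insert hk, hessian_add, ih]

/-- **`𝓗(D_a f) = Σ_k a_k 𝓗(∂_k f)`** — for a cubic `F`, `𝓗(D_a F) = 𝓗_F(a)` is the Hessian of `F` AT the point `a`.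
[cite: BrandenHuh2019, §2.3 proof of Lemma 2.15 ("`(d-2) 𝓗_f = Σ_i w_i 𝓗_{∂_i f}`")] -/
theorem hessian_dirDeriv (a : σ → ℝ) (f : MvPolynomial σ ℝ) :
    hessian (dirDeriv a f) = ∑ k, a k • hessian (pderiv k f) := by
  rw [dirDeriv, hessian_sum]
  exact Finset.sum_congr rfl fun k _ ↦ hessian_smul _ _

/-- `𝓗(∂_k F)_{ij} = c_{e_i+e_j+e_k}(F)` — the slices of the symmetric 3-tensor of normalized coefficients.
[cite: BrandenHuh2019, §2.1 (p. 8), §2.2 (p. 11, normalized coefficients)] -/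
theorem hessian_pderiv_apply (k : σ) (F : MvPolynomial σ ℝ) (i j : σ) :
    hessian (pderiv k F) i j = normCoeff (Finsupp.single i 1 + Finsupp.single j 1 + Finsupp.single k 1) F := by
  rw [hessian_apply_eq_normCoeff, normCoeff_pderiv]

/-- `𝓗(D_a F)_{ij} = Σ_k a_k c_{e_i+e_j+e_k}(F)`. [cite: BrandenHuh2019, §2.3 proof of Lemma 2.15] -/
theorem hessian_dirDeriv_apply (a : σ → ℝ) (F : MvPolynomial σ ℝ) (i j : σ) :
    hessian (dirDeriv a F) i j =
      ∑ k, a k * normCoeff (Finsupp.single i 1 + Finsupp.single j 1 + Finsupp.single k 1) F := by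
  rw [hessian_dirDeriv, Matrix.sum_apply]
  exact Finset.sum_congr rfl fun k _ ↦ by rw [Matrix.smul_apply, smul_eq_mul, hessian_pderiv_apply]

/-- **The symmetry of the 3-tensor**: `𝓗(D_a F) e_n = 𝓗(∂_n F) a` (both have `i`-th entry `Σ_k a_k c_{e_i+e_n+e_k}`).
[cite: BrandenHuh2019, §2.3 proof of Lemma 2.15 ("`(d-2) e_i^T 𝓗_f = w^T 𝓗_{∂_i f}`")] -/
theorem hessian_dirDeriv_mulVec_single [DecidableEq σ] (a : σ → ℝ) (F : MvPolynomial σ ℝ) (n : σ) :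
    (hessian (dirDeriv a F)).mulVec (Pi.single n 1) = (hessian (pderiv n F)).mulVec a := by
  ext i
  rw [Matrix.mulVec_single_one, Matrix.col_apply, hessian_dirDeriv_apply, Matrix.mulVec, dotProduct]
  refine Finset.sum_congr rfl fun k _ ↦ ?_
  rw [hessian_pderiv_apply, add_right_comm, mul_comm]

variable [DecidableEq σ]

/-- A real symmetric matrix gives a symmetric bilinear form `(u, v) ↦ uᵀMv`. [cite: ShenfeldVanHandel2019, Lemma 2.9
("Let `A` be a symmetric matrix")] -/
theorem isSymm_toBilin'_of_isSymm {M : Matrix σ σ ℝ} (hM : M.IsSymm) : LinearMap.IsSymm (Matrix.toBilin' M) :=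
  ⟨fun v w ↦ by
    rw [Matrix.toBilin'_apply', Matrix.toBilin'_apply', Matrix.dotProduct_mulVec, ← Matrix.mulVec_transpose, hM.eq,
      dotProduct_comm, RingHom.id_apply]⟩

/-- `uᵀMv ≥ 0` for a matrix with nonnegative entries and nonnegative vectors. [cite: BrandenHuh2019, §2.1 proof of
Lemma 2.5 ("Since `f ∈ P²_n`, we have `u^T 𝓗_f u > 0`")] -/
theorem toBilin'_nonneg_of_nonneg {M : Matrix σ σ ℝ} (hM : ∀ i j, 0 ≤ M i j) {u v : σ → ℝ} (hu : ∀ i, 0 ≤ u i)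
    (hv : ∀ i, 0 ≤ v i) : 0 ≤ Matrix.toBilin' M u v := by
  rw [Matrix.toBilin'_apply]
  exact Finset.sum_nonneg fun i _ ↦ Finset.sum_nonneg fun j _ ↦
    mul_nonneg (mul_nonneg (hu i) (hM i j)) (hv j)

end DirDeriv

/-! ## §2 The two-term step: `M + N` for matrices bordered by a common vector (Lemma 2.9 (1) + (4)) -/

section Step

variable [Fintype σ] [DecidableEq σ]

/-- **The two-term step** (Brändén–Huh's proof of Prop. 2.7, case `α_i > 0`, in signature language): let `M`, `N` be
symmetric with at most one positive square each, and suppose `u = Mb = Na ≠ 0` for vectors with `bᵀMb ≥ 0`, `aᵀNa ≥ 0`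
(for Brändén–Huh: `M = 𝓗(∂_i F')`, `N = θ α_i 𝓗(∂_j F')`, `u` = the common linear form `∂_i ∂_j F'`). Then `M + N` has at
most one positive square: `[[M,u],[uᵀ,0]]` and `[[N,u],[uᵀ,0]]` have at most one positive square (Lemma 2.9 (1):
`sigPos_bordered_mulVec_le`), share the isotropic vector `e_{n+1}` and the functional `u`, so their sum
`[[M+N, 2u],[2uᵀ,0]]` has at most one positive square (Lemma 2.9 (4): `sigPos_add_le_one_of_isotropic`), and `M + N`
is its corner. [cite: BrandenHuh2019, §2.2 proof of Prop. 2.7 (case `α_i > 0`: Lemma 2.9 (1), (2), (4))] -/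
theorem sigPos_toBilin'_add_le_one {M N : Matrix σ σ ℝ} (hM : M.IsSymm) (hN : N.IsSymm)
    (h1M : sigPos (Matrix.toBilin' M).toQuadraticMap ≤ 1) (h1N : sigPos (Matrix.toBilin' N).toQuadraticMap ≤ 1)
    {a b : σ → ℝ} (hb : 0 ≤ Matrix.toBilin' M b b) (ha : 0 ≤ Matrix.toBilin' N a a)
    (hu : M.mulVec b = N.mulVec a) (hu0 : M.mulVec b ≠ 0) :
    sigPos (Matrix.toBilin' (M + N)).toQuadraticMap ≤ 1 := by
  have hM' := sigPos_bordered_mulVec_le M hM hb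
  have hN' := sigPos_bordered_mulVec_le N hN ha
  rw [← hu] at hN'
  obtain ⟨a₀, ha₀⟩ := Function.ne_iff.1 hu0
  have key := sigPos_add_le_one_of_isotropic (Matrix.toBilin' (bordered M (M.mulVec b)))
    (Matrix.toBilin' (bordered N (M.mulVec b))) (isSymm_toBilin'_of_isSymm (isSymm_bordered hM _))
    (isSymm_toBilin'_of_isSymm (isSymm_bordered hN _)) (hM'.trans h1M) (hN'.trans h1N)
    (e := Pi.single none 1) (y₀ := Pi.single (some a₀) 1)
    (toBilin'_bordered_none_none M _) (toBilin'_bordered_none_none N _)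
    (fun z ↦ by rw [toBilin'_bordered_none, toBilin'_bordered_none])
    (by
      rw [toBilin'_bordered_none, Finset.sum_eq_single a₀]
      · simpa using ha₀
      · intro c _ hc
        rw [Pi.single_apply, if_neg (fun h ↦ hc (Option.some_injective _ h)), mul_zero]
      · intro h; exact absurd (Finset.mem_univ _) h)
  rw [← map_add, bordered_add] at key
  have hsub : (bordered (M + N) (M.mulVec b + M.mulVec b)).submatrix some some = M + N := by
    ext i j; simp
  calc sigPos (Matrix.toBilin' (M + N)).toQuadraticMap
      = sigPos (Matrix.toBilin' ((bordered (M + N) (M.mulVec b + M.mulVec b)).submatrix some some)).toQuadraticMap := by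
        rw [hsub]
    _ ≤ sigPos (Matrix.toBilin' (bordered (M + N) (M.mulVec b + M.mulVec b))).toQuadraticMap :=
        sigPos_submatrix_some_le _
    _ ≤ 1 := key

end Step

/-! ## §3 The cubic 3-tensor of an `F ∈ L³_n`: slices, adjacency, connectivity from M-convexity -/

section Cubic

variable [Fintype σ]

/-- For `F ∈ L³_n`, each slice `𝓗(∂_k F)` has at most one positive square (`∂_k F ∈ L²_n`).
[cite: BrandenHuh2019, §2.2 Def. 2.6 (`∂_i f ∈ L^{d-1}_n`)] -/
theorem sigPos_hessian_pderiv_le_one [DecidableEq σ] {F : MvPolynomial σ ℝ} (hF : F ∈ lorentzian σ 3) (k : σ) :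
    sigPos (Matrix.toBilin' (hessian (pderiv k F))).toQuadraticMap ≤ 1 :=
  (mem_lorentzian_two.1 (pderiv_mem_lorentzian hF k)).2.2.2

/-- A positive multiple of a slice has at most one positive square. [cite: BrandenHuh2019, §2.2 Def. 2.6; Lemma 2.9 (3)] -/
theorem sigPos_hessian_smul_pderiv_le_one [DecidableEq σ] {F : MvPolynomial σ ℝ} (hF : F ∈ lorentzian σ 3) (k : σ) {c : ℝ}
    (hc : 0 < c) : sigPos (Matrix.toBilin' (hessian (c • pderiv k F))).toQuadraticMap ≤ 1 :=
  (mem_lorentzian_two.1 (smul_mem_lorentzian (pderiv_mem_lorentzian hF k) hc.le)).2.2.2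

/-- `∂_k F ≠ 0` for a cubic `F` gives a monomial `w_k w_i w_j` in the support. [cite: BrandenHuh2019, §2.2 proof of
Prop. 2.7 ("there are monomials of the form `w_i w_{i'} w_{i''}` […] in the support of `f`")] -/
theorem exists_coeff_ne_zero_of_pderiv_ne_zero {F : MvPolynomial σ ℝ} (hF : F.IsHomogeneous 3) {k : σ}
    (hk : pderiv k F ≠ 0) :
    ∃ i j, coeff (Finsupp.single k 1 + Finsupp.single i 1 + Finsupp.single j 1) F ≠ 0 := by
  obtain ⟨β, hβ⟩ := MvPolynomial.ne_zero_iff.1 hk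
  have hβ' : normCoeff (β + Finsupp.single k 1) F ≠ 0 := by
    rw [← normCoeff_pderiv]; exact fun h ↦ hβ (normCoeff_eq_zero_iff.1 h)
  have hdeg : (β + Finsupp.single k 1).degree = 3 := by
    by_contra h
    exact hβ' (normCoeff_eq_zero_iff.2 (hF.coeff_eq_zero h))
  have hβ2 : β.degree = 2 := by
    rw [map_add, Finsupp.degree_single] at hdeg; omega
  obtain ⟨i, j, rfl⟩ := exists_eq_single_add_single_of_degree_eq_two hβ2
  refine ⟨i, j, fun h ↦ hβ' (normCoeff_eq_zero_iff.2 ?_)⟩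
  rwa [show (Finsupp.single i 1 + Finsupp.single j 1 + Finsupp.single k 1 : σ →₀ ℕ) =
    Finsupp.single k 1 + Finsupp.single i 1 + Finsupp.single j 1 from by abel]

/-- A monomial `w_n w_k w_i` in the support of `F` gives `∂_n ∂_k F ≠ 0`. [cite: BrandenHuh2019, §2.2 proof of Prop. 2.7
("Since `∂_i ∂_{i'} f` is not identically zero")] -/
theorem pderiv_pderiv_ne_zero_of_coeff_ne_zero {F : MvPolynomial σ ℝ} {n k i : σ}
    (h : coeff (Finsupp.single n 1 + Finsupp.single k 1 + Finsupp.single i 1) F ≠ 0) :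
    pderiv n (pderiv k F) ≠ 0 := by
  rw [MvPolynomial.ne_zero_iff]
  refine ⟨Finsupp.single i 1, fun h0 ↦ h ?_⟩
  have h1 : normCoeff (Finsupp.single i 1 + Finsupp.single n 1 + Finsupp.single k 1) F = 0 := by
    rw [← normCoeff_pderiv, ← normCoeff_pderiv]; exact normCoeff_eq_zero_iff.2 h0
  rw [show (Finsupp.single n 1 + Finsupp.single k 1 + Finsupp.single i 1 : σ →₀ ℕ) =
    Finsupp.single i 1 + Finsupp.single n 1 + Finsupp.single k 1 from by abel]
  exact normCoeff_eq_zero_iff.1 h1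

/-- `∂_n ∂_k F ≠ 0` for a cubic `F` gives a monomial `w_n w_k w_i` in the support. [cite: BrandenHuh2019, §2.2 proof of
Prop. 2.7] -/
theorem exists_coeff_ne_zero_of_pderiv_pderiv_ne_zero {F : MvPolynomial σ ℝ} (hF : F.IsHomogeneous 3) {n k : σ}
    (h : pderiv n (pderiv k F) ≠ 0) :
    ∃ i, coeff (Finsupp.single n 1 + Finsupp.single k 1 + Finsupp.single i 1) F ≠ 0 := by
  obtain ⟨β, hβ⟩ := MvPolynomial.ne_zero_iff.1 h
  replace hβ : normCoeff (β + Finsupp.single n 1 + Finsupp.single k 1) F ≠ 0 := by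
    rw [← normCoeff_pderiv, ← normCoeff_pderiv]; exact fun h' ↦ hβ (normCoeff_eq_zero_iff.1 h')
  have hdeg : (β + Finsupp.single n 1 + Finsupp.single k 1).degree = 3 := by
    by_contra h'
    exact hβ (normCoeff_eq_zero_iff.2 (hF.coeff_eq_zero h'))
  have hβ1 : β.degree = 1 := by
    rw [map_add, map_add, Finsupp.degree_single, Finsupp.degree_single] at hdeg; omega
  have hβ0 : β ≠ 0 := by intro h0; rw [h0, map_zero] at hβ1; exact zero_ne_one hβ1
  obtain ⟨i, hi⟩ := Finsupp.ne_iff.1 hβ0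
  rw [Finsupp.coe_zero, Pi.zero_apply] at hi
  have hβe := eq_single_of_degree_eq_one hβ1 hi
  refine ⟨i, fun h0 ↦ hβ (normCoeff_eq_zero_iff.2 ?_)⟩
  rwa [hβe, show (Finsupp.single i 1 + Finsupp.single n 1 + Finsupp.single k 1 : σ →₀ ℕ) =
    Finsupp.single n 1 + Finsupp.single k 1 + Finsupp.single i 1 from by abel]

/-- `∂_n ∂_k F ≠ 0` forces `∂_n F ≠ 0`. [cite: BrandenHuh2019, §2.2 proof of Prop. 2.7] -/
theorem pderiv_ne_zero_of_pderiv_pderiv_ne_zero {F : MvPolynomial σ ℝ} {n k : σ} (h : pderiv n (pderiv k F) ≠ 0) :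
    pderiv n F ≠ 0 := by
  intro h0
  apply h
  rw [pderiv_pderiv_comm, h0, map_zero]

/-- **Connectivity of the support graph from M-convexity** (Brändén–Huh's exchange step in the degenerate case of
Prop. 2.7): let `F` be a cubic with nonnegative coefficients and M-convex support. If a set `S` of indices contains some
`k` with `∂_k F ≠ 0` and misses some `k'` with `∂_{k'} F ≠ 0`, then some `n ∉ S` and `k ∈ S` have `∂_n ∂_k F ≠ 0`.
("We apply the symmetric exchange property to the support of `f`, the monomials `w_i w_{i'} w_{i''}`, `w_j w_{j'} w_{j''}`,
and the variable `w_i`"; here the one-sided exchange property suffices.) [cite: BrandenHuh2019, §2.2 proof of Prop. 2.7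
(the case "`∂^{α+e_j} f` is identically zero")] -/
theorem exists_pderiv_pderiv_ne_zero_of_subset [DecidableEq σ] {F : MvPolynomial σ ℝ} (hF : F.IsHomogeneous 3)
    (hM : IsMConvex {α | coeff α F ≠ 0}) (S : Finset σ) {k k' : σ} (hkS : k ∈ S) (hk : pderiv k F ≠ 0)
    (hk'S : k' ∉ S) (hk' : pderiv k' F ≠ 0) : ∃ n, n ∉ S ∧ ∃ k ∈ S, pderiv n (pderiv k F) ≠ 0 := by
  obtain ⟨i, j, hα⟩ := exists_coeff_ne_zero_of_pderiv_ne_zero hF hk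
  obtain ⟨i', j', hβ⟩ := exists_coeff_ne_zero_of_pderiv_ne_zero hF hk'
  -- if `i ∉ S` (or `j ∉ S`), it is adjacent to `k ∈ S`
  by_cases hiS : i ∈ S
  swap
  · refine ⟨i, hiS, k, hkS, pderiv_pderiv_ne_zero_of_coeff_ne_zero (i := j) ?_⟩
    rwa [add_comm (Finsupp.single i 1)]
  by_cases hjS : j ∈ S
  swap
  · refine ⟨j, hjS, k, hkS, pderiv_pderiv_ne_zero_of_coeff_ne_zero (i := i) ?_⟩
    rwa [add_comm (Finsupp.single j 1), add_right_comm]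
  -- if `i' ∈ S` (or `j' ∈ S`), then `k' ∉ S` is adjacent to it
  by_cases hi'S : i' ∈ S
  · exact ⟨k', hk'S, i', hi'S, pderiv_pderiv_ne_zero_of_coeff_ne_zero hβ⟩
  by_cases hj'S : j' ∈ S
  · refine ⟨k', hk'S, j', hj'S, pderiv_pderiv_ne_zero_of_coeff_ne_zero (i := i') ?_⟩
    rwa [add_right_comm]
  -- otherwise exchange `α = e_k + e_i + e_j`, `β = e_{k'} + e_{i'} + e_{j'}` at `k`: `e_i + e_j + e_m ∈ supp F`, `m ∉ S`
  have hne : ∀ x, x ∉ S → x ≠ k := fun x hx h ↦ hx (by rw [h]; exact hkS)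
  have hlt : (Finsupp.single k' 1 + Finsupp.single i' 1 + Finsupp.single j' 1 : σ →₀ ℕ) k <
      (Finsupp.single k 1 + Finsupp.single i 1 + Finsupp.single j 1 : σ →₀ ℕ) k := by
    simp only [Finsupp.add_apply, Finsupp.single_eq_same, Finsupp.single_eq_of_ne (hne k' hk'S).symm,
      Finsupp.single_eq_of_ne (hne i' hi'S).symm, Finsupp.single_eq_of_ne (hne j' hj'S).symm]
    omega
  obtain ⟨m, hm, hmem⟩ := hM hα hβ k hlt
  have hmS : m ∉ S := by
    intro hmS'
    have h1 : (Finsupp.single k' 1 + Finsupp.single i' 1 + Finsupp.single j' 1 : σ →₀ ℕ) m = 0 := by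
      rw [Finsupp.add_apply, Finsupp.add_apply, Finsupp.single_eq_of_ne (fun h ↦ hk'S (by rw [← h]; exact hmS')),
        Finsupp.single_eq_of_ne (fun h ↦ hi'S (by rw [← h]; exact hmS')),
        Finsupp.single_eq_of_ne (fun h ↦ hj'S (by rw [← h]; exact hmS')), add_zero, add_zero]
    rw [h1] at hm
    exact Nat.not_lt_zero _ hm
  refine ⟨m, hmS, i, hiS, pderiv_pderiv_ne_zero_of_coeff_ne_zero (i := j) ?_⟩
  rw [Set.mem_setOf_eq, add_assoc, add_tsub_cancel_left] at hmem
  rwa [add_rotate]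

end Cubic

/-! ## §4 The growth induction and the Hodge–Riemann relation for Lorentzian cubics -/

section Growth

variable [Fintype σ] [DecidableEq σ]

/-- The restriction `b_S` of a direction `b` to a set of indices. [cite: BrandenHuh2019, §2.2 Cor. 2.11] -/
private def restrictVec (S : Finset σ) (b : σ → ℝ) : σ → ℝ := fun k ↦ if k ∈ S then b k else 0

omit [Fintype σ] in
/-- `b_S ≥ 0` for `b > 0`. [cite: BrandenHuh2019, §2.2 Cor. 2.11 ("`a_1, …, a_n ≥ 0`")] -/
private theorem restrictVec_nonneg (S : Finset σ) {b : σ → ℝ} (hb : ∀ k, 0 < b k) (k : σ) : 0 ≤ restrictVec S b k := by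
  unfold restrictVec; split_ifs; exact (hb k).le; exact le_rfl

omit [Fintype σ] in
/-- `b_{S ∪ {n}} = b_S + b_n e_n` for `n ∉ S`. [cite: BrandenHuh2019, §2.2 Cor. 2.11] -/
private theorem restrictVec_insert (S : Finset σ) {n : σ} (hn : n ∉ S) (b : σ → ℝ) :
    restrictVec (insert n S) b = restrictVec S b + Pi.single n (b n) := by
  ext k
  simp only [restrictVec, Pi.add_apply, Finset.mem_insert]
  by_cases hk : k = n
  · subst hk; rw [if_pos (Or.inl rfl), if_neg hn, Pi.single_eq_same, zero_add]
  · rw [Pi.single_eq_of_ne hk, add_zero]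
    by_cases hkS : k ∈ S
    · rw [if_pos (Or.inr hkS), if_pos hkS]
    · rw [if_neg (by tauto), if_neg hkS]

/-- **The growth step** (Brändén–Huh Prop. 2.7, non-degenerate case, as a step of an induction over the indices): for
`F ∈ L³_n`, `b > 0`, a set `S` of indices with `sigPos 𝓗(D_{b_S} F) ≤ 1`, and `n ∉ S` with `∂_n ∂_k F ≠ 0` for some
`k ∈ S`, also `sigPos 𝓗(D_{b_{S ∪ {n}}} F) ≤ 1` — the two-term step `sigPos_toBilin'_add_le_one` with
`M = 𝓗(D_{b_S} F)`, `N = b_n 𝓗(∂_n F)` and the common nonzero vector `u = M e_n = 𝓗(∂_n F) b_S`.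
[cite: BrandenHuh2019, §2.2 proof of Prop. 2.7 (case `α_i > 0`, "unless `∂^{α+e_j} f` is identically zero")] -/
private theorem sigPos_hessian_dirDeriv_insert_le_one {F : MvPolynomial σ ℝ} (hF : F ∈ lorentzian σ 3) {b : σ → ℝ}
    (hb : ∀ k, 0 < b k) (S : Finset σ) {n k : σ} (hn : n ∉ S) (hk : k ∈ S) (hadj : pderiv n (pderiv k F) ≠ 0)
    (hS : sigPos (Matrix.toBilin' (hessian (dirDeriv (restrictVec S b) F))).toQuadraticMap ≤ 1) :
    sigPos (Matrix.toBilin' (hessian (dirDeriv (restrictVec (insert n S) b) F))).toQuadraticMap ≤ 1 := by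
  have hhom := isHomogeneous_of_mem_lorentzian hF
  have hnn := coeff_nonneg_of_mem_lorentzian hF
  rw [restrictVec_insert S hn b, dirDeriv_add, dirDeriv_single, hessian_add]
  set M := hessian (dirDeriv (restrictVec S b) F) with hMdef
  set N := hessian (b n • pderiv n F) with hNdef
  -- the common vector `u = M e_n = 𝓗(∂_n F) b_S = N ((b n)⁻¹ b_S)`
  have hNa : N.mulVec ((b n)⁻¹ • restrictVec S b) = (hessian (pderiv n F)).mulVec (restrictVec S b) := by
    rw [hNdef, hessian_smul, Matrix.smul_mulVec, Matrix.mulVec_smul, smul_smul, mul_inv_cancel₀ (hb n).ne',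
      one_smul]
  have hu : M.mulVec (Pi.single n 1) = N.mulVec ((b n)⁻¹ • restrictVec S b) := by
    rw [hNa, hMdef, hessian_dirDeriv_mulVec_single]
  -- `u ≠ 0`: `u_i ≥ b_k c_{e_i+e_n+e_k} > 0` for a monomial `w_n w_k w_i` of `F`
  obtain ⟨i, hi⟩ := exists_coeff_ne_zero_of_pderiv_pderiv_ne_zero hhom hadj
  have hu0 : M.mulVec (Pi.single n 1) ≠ 0 := by
    rw [hMdef, hessian_dirDeriv_mulVec_single]
    intro h0
    have hi0 := congrFun h0 i
    rw [Pi.zero_apply, Matrix.mulVec, dotProduct] at hi0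
    have hle : hessian (pderiv n F) i k * restrictVec S b k ≤
        ∑ j, hessian (pderiv n F) i j * restrictVec S b j :=
      Finset.single_le_sum (f := fun j ↦ hessian (pderiv n F) i j * restrictVec S b j)
        (fun j _ ↦ mul_nonneg (hessian_nonneg (coeff_pderiv_nonneg hnn n) i j) (restrictVec_nonneg S hb j))
        (Finset.mem_univ k)
    have hpos : 0 < hessian (pderiv n F) i k * restrictVec S b k := by
      refine mul_pos ?_ (by unfold restrictVec; rw [if_pos hk]; exact hb k)
      rw [hessian_pderiv_apply]
      refine lt_of_le_of_ne (normCoeff_nonneg_iff.2 (hnn _)) (Ne.symm ?_)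
      rw [ne_eq, normCoeff_eq_zero_iff, show (Finsupp.single i 1 + Finsupp.single k 1 + Finsupp.single n 1 : σ →₀ ℕ) =
        Finsupp.single n 1 + Finsupp.single k 1 + Finsupp.single i 1 from by abel]
      exact hi
    rw [hi0] at hle
    exact absurd hle (not_le.2 hpos)
  refine sigPos_toBilin'_add_le_one (isSymm_hessian _) (isSymm_hessian _) hS
    (sigPos_hessian_smul_pderiv_le_one hF n (hb n)) ?_ ?_ hu hu0
  · -- `e_nᵀ M e_n = M_{nn} ≥ 0`
    exact toBilin'_nonneg_of_nonneg
      (hessian_nonneg (coeff_dirDeriv_nonneg (restrictVec_nonneg S hb) hnn))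
      (fun j ↦ by rw [Pi.single_apply]; split_ifs <;> norm_num) (fun j ↦ by rw [Pi.single_apply]; split_ifs <;> norm_num)
  · -- `aᵀ N a ≥ 0`
    refine toBilin'_nonneg_of_nonneg (hessian_nonneg fun α ↦ ?_) ?_ ?_
    · rw [coeff_smul, smul_eq_mul]; exact mul_nonneg (hb n).le (coeff_pderiv_nonneg hnn n α)
    · exact fun j ↦ by rw [Pi.smul_apply, smul_eq_mul]; exact mul_nonneg (inv_nonneg.2 (hb n).le) (restrictVec_nonneg S hb j)
    · exact fun j ↦ by rw [Pi.smul_apply, smul_eq_mul]; exact mul_nonneg (inv_nonneg.2 (hb n).le) (restrictVec_nonneg S hb j)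

/-- **The growth induction**: from a nonempty `S ⊆ σ' = {k : ∂_k F ≠ 0}` with `sigPos 𝓗(D_{b_S} F) ≤ 1` to
`sigPos 𝓗(D_{b_{σ'}} F) ≤ 1`, adding one adjacent index at a time (`exists_pderiv_pderiv_ne_zero_of_subset` supplies it).
[cite: BrandenHuh2019, §2.2 proof of Prop. 2.7 and of Thm. 2.10] -/
private theorem sigPos_hessian_dirDeriv_le_one_grow {F : MvPolynomial σ ℝ} (hF : F ∈ lorentzian σ 3) {b : σ → ℝ}
    (hb : ∀ k, 0 < b k) :
    ∀ (m : ℕ) (S : Finset σ), S ⊆ univ.filter (fun k ↦ pderiv k F ≠ 0) → S.Nonempty →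
      (univ.filter (fun k ↦ pderiv k F ≠ 0)).card ≤ S.card + m →
      sigPos (Matrix.toBilin' (hessian (dirDeriv (restrictVec S b) F))).toQuadraticMap ≤ 1 →
      sigPos (Matrix.toBilin' (hessian (dirDeriv (restrictVec (univ.filter (fun k ↦ pderiv k F ≠ 0)) b) F))).toQuadraticMap
        ≤ 1 := by
  intro m
  induction m with
  | zero =>
    intro S hS _ hcard h
    rwa [← Finset.eq_of_subset_of_card_le hS (by omega)]
  | succ m ih =>
    intro S hS hne hcard h
    by_cases hcard' : (univ.filter (fun k ↦ pderiv k F ≠ 0)).card ≤ S.card + m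
    · exact ih S hS hne hcard' h
    · -- `S ⊊ σ'`: pick `k' ∈ σ' \\ S`, then an adjacent `n ∉ S`
      obtain ⟨k', hk'σ, hk'S⟩ := Finset.exists_mem_notMem_of_card_lt_card (s := S)
        (t := univ.filter (fun k ↦ pderiv k F ≠ 0)) (by omega)
      obtain ⟨k, hk⟩ := hne
      have hkF : pderiv k F ≠ 0 := (Finset.mem_filter.1 (hS hk)).2
      have hk'F : pderiv k' F ≠ 0 := (Finset.mem_filter.1 hk'σ).2
      obtain ⟨n, hnS, k₁, hk₁, hadj⟩ := exists_pderiv_pderiv_ne_zero_of_subset (isHomogeneous_of_mem_lorentzian hF)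
        (isMConvex_support_of_mem_lorentzian hF) S hk hkF hk'S hk'F
      have hnσ : n ∈ univ.filter (fun k ↦ pderiv k F ≠ 0) :=
        Finset.mem_filter.2 ⟨Finset.mem_univ _, pderiv_ne_zero_of_pderiv_pderiv_ne_zero hadj⟩
      have hstep := sigPos_hessian_dirDeriv_insert_le_one hF hb S hnS hk₁ hadj h
      refine ih (insert n S) (Finset.insert_subset hnσ hS) (Finset.insert_nonempty _ _) ?_ hstep
      rw [Finset.card_insert_of_notMem hnS]; omega

/-- **Hodge–Riemann for Lorentzian cubics, positive directions**: for `F ∈ L³_n` and `b ∈ ℝ^n_{>0}`, the Hessian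
`𝓗(D_b F) = 𝓗_F(b)` has at most one positive eigenvalue. [cite: BrandenHuh2019, §2.3 Thm. 2.16 (2) (`d = 3`); §2.2
Cor. 2.11 (`d = 3`)] -/
theorem sigPos_hessian_dirDeriv_le_one_of_pos {F : MvPolynomial σ ℝ} (hF : F ∈ lorentzian σ 3) {b : σ → ℝ}
    (hb : ∀ k, 0 < b k) : sigPos (Matrix.toBilin' (hessian (dirDeriv b F))).toQuadraticMap ≤ 1 := by
  -- `D_b F = D_{b_{σ'}} F` for `σ' = {k : ∂_k F ≠ 0}`
  have hcongr : dirDeriv b F = dirDeriv (restrictVec (univ.filter (fun k ↦ pderiv k F ≠ 0)) b) F := by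
    refine dirDeriv_congr fun k hk ↦ ?_
    by_contra hkF
    apply hk
    have hkσ : k ∈ univ.filter (fun k ↦ pderiv k F ≠ 0) := Finset.mem_filter.2 ⟨Finset.mem_univ _, hkF⟩
    unfold restrictVec
    rw [if_pos hkσ]
  rw [hcongr]
  rcases (univ.filter (fun k ↦ pderiv k F ≠ 0)).eq_empty_or_nonempty with hempty | ⟨k₀, hk₀⟩
  · -- no variable occurs: `D F = 0 ∈ L²`
    have h0 : dirDeriv (restrictVec (univ.filter (fun k ↦ pderiv k F ≠ 0)) b) F = 0 := by
      refine Finset.sum_eq_zero fun k _ ↦ ?_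
      unfold restrictVec
      rw [hempty, if_neg (Finset.notMem_empty k), zero_smul]
    rw [h0]
    exact (mem_lorentzian_two.1 (zero_mem_lorentzian (σ := σ) 2)).2.2.2
  · -- grow from `{k₀}`
    refine sigPos_hessian_dirDeriv_le_one_grow hF hb (univ.filter (fun k ↦ pderiv k F ≠ 0)).card {k₀}
      (Finset.singleton_subset_iff.2 hk₀) (Finset.singleton_nonempty k₀) (by omega) ?_
    have h1 : dirDeriv (restrictVec {k₀} b) F = b k₀ • pderiv k₀ F := by
      rw [← dirDeriv_single]
      congr 1
      ext k
      simp only [restrictVec, Finset.mem_singleton]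
      by_cases h : k = k₀
      · subst h; rw [if_pos rfl, Pi.single_eq_same]
      · rw [if_neg h, Pi.single_eq_of_ne h]
    rw [h1]
    exact sigPos_hessian_smul_pderiv_le_one hF k₀ (hb k₀)

/-- **Hodge–Riemann for Lorentzian cubics** (Brändén–Huh Thm. 2.16 (2) at `d = 3`, at every point of the CLOSED orthant;
equivalently the Hessian condition of Cor. 2.11 at `d = 3`): for `F ∈ L³_n` and `a ∈ ℝ^n_{≥0}`, the quadratic form
`D_a F = Σ_k a_k ∂_k F`, whose Hessian is `𝓗_F(a) = (∂_i∂_j F(a))_{ij}`, has at most one positive eigenvalue. From the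
positive case by `𝓗(D_{a+ε𝟙} F) = 𝓗(D_a F) + ε 𝓗(D_𝟙 F)` and "stability is a closed condition"
(`sigPos_le_one_of_forall_pos_add_smul`). [cite: BrandenHuh2019, §2.3 Thm. 2.16 (2); §2.2 Cor. 2.11, Prop. 2.7] -/
theorem sigPos_hessian_dirDeriv_le_one {F : MvPolynomial σ ℝ} (hF : F ∈ lorentzian σ 3) {a : σ → ℝ}
    (ha : ∀ k, 0 ≤ a k) : sigPos (Matrix.toBilin' (hessian (dirDeriv a F))).toQuadraticMap ≤ 1 := by
  refine sigPos_le_one_of_forall_pos_add_smul (Matrix.toBilin' (hessian (dirDeriv a F)))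
    (Matrix.toBilin' (hessian (dirDeriv (fun _ ↦ (1 : ℝ)) F))) (isSymm_toBilin'_of_isSymm (isSymm_hessian _))
    (isSymm_toBilin'_of_isSymm (isSymm_hessian _)) fun ε hε ↦ ?_
  have h : Matrix.toBilin' (hessian (dirDeriv a F)) + ε • Matrix.toBilin' (hessian (dirDeriv (fun _ ↦ (1 : ℝ)) F)) =
      Matrix.toBilin' (hessian (dirDeriv (a + ε • fun _ ↦ (1 : ℝ)) F)) := by
    rw [dirDeriv_add, dirDeriv_smul, hessian_add, hessian_smul, map_add, map_smul]
  rw [h]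
  exact sigPos_hessian_dirDeriv_le_one_of_pos hF fun k ↦ by
    simp only [Pi.add_apply, Pi.smul_apply, smul_eq_mul, mul_one]; linarith [ha k]

end Growth

end Literature.Combinatorics.LorentzianPolynomials

end
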